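import Mathlib
import HarnessLib
import Literature.Analysis.FluidPDE.TypeIAncientMild
import Literature.Analysis.FluidPDE.OseenSlice
import Literature.Analysis.FluidPDE.UlocKernelEstimates
import Literature.Analysis.FluidPDE.LerayVolterraComparison
import Literature.Analysis.FluidPDE.OseenDuhamelPairCalculus
import Summits.NavierStokesRegularity.NavierStokesRegularity.Theorems.QuarterLogPincerTruncationEdgeDefs
import Summits.NavierStokesRegularity.NavierStokesRegularity.Theorems.QuarterLogPincerTypeIQuantSubcubicExpFrameTools
import Summits.NavierStokesRegularity.NavierStokesRegularity.Theorems.QuarterLogPincerQuietCoreDefs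
import Summits.NavierStokesRegularity.NavierStokesRegularity.Theorems.QuarterLogPincerQuietCoreBudgetPassSlice
import Summits.NavierStokesRegularity.NavierStokesRegularity.Theorems.QuarterLogPincerQuietCoreBudgetPass

/-!
# Route `QuarterLogPincer`, crux `TypeIQuantSubcubicExp` (stmt-NavierStokesRegularity-24077), line `quiet_core` —
# §1c (PROVED in-file v1.3; ported VERBATIM): the S3♭ toolbox — receding-ball slice bound, two-region caloric maximum principle, QC from S3♭ + S4♭

`setIntegral_Ioi_sq_indicator_rpow_neg_four`, `integral_indicator_compl_ball_norm_rpow_neg_four` (H1), `norm_oseenSlice_receding` (T2),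
`heatKernel_le_tail_mul_heatKernel_two_mul`, `norm_heatExtension_two_region` (T3), and the compositions `quietCore_of_upgrade_of_pass`,
`stubQuietCore_of`.
HONEST FRAME: estimates about HYPOTHETICAL Type-I ancient mild fields; nothing here bears on 24077, W7 or Navier–Stokes
regularity (OPEN).  Port by the pub-ns-dss typer (g36), DIRECTOR-NS KEY-NS #181/#182; bodies VERBATIM from tree `Lines/quiet_core.lean`
v1.5 (sha12 d1a96bf31391, ns-idea-7 g10; critic of record idea-crit-4 g6); docstrings added where the line had none.
-/

noncomputable section

set_option linter.dupNamespace false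

namespace Summit.NavierStokesRegularity.NavierStokesRegularity.Cruxes.TypeIQuantSubcubicExp.QuietCore

open MeasureTheory Set Function Metric Filter Topology
open scoped ENNReal NNReal
open Literature.Analysis Literature.Analysis.FluidPDE
open Summit.NavierStokesRegularity.NavierStokesRegularity.Cruxes.TypeIQuantSubcubicExp.TruncationEdge

/-! ### §1c  S3♭ toolbox (PROVED, v1.3): three of the four lemmas of the receding-ball bootstrap planned for S3♭
(card `Lines/quiet-core.md` §Addendum): H1 the exterior kernel mass by polar coordinates (`∫_{‖z‖≥d}‖z‖^{-4} = 4π/d`),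
T2 the receding-ball slice bound (inside sup / outside Type-I field, `min(Iσ^{-1/2}, 4π/d)`), T3 the two-region maximum
principle with Gaussian tail.  Remaining for S3♭: T1 (far-kick calculus for the log-corrected recession law) and T4
(the real-induction assembly).  #### H1: exterior kernel mass -/

/-- Radial part: `∫_{(0,∞)} r^{3−1} • 𝟙_{[d,∞)}(r) r^{−4} dr = 1/d` for `d > 0`. -/
theorem setIntegral_Ioi_sq_indicator_rpow_neg_four {d : ℝ} (hd : 0 < d) :
    ∫ r in Ioi (0 : ℝ), r ^ (3 - 1) • (Ici d).indicator (fun r => r ^ (-(4 : ℝ))) r = 1 / d := by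
  have hfun : (fun r : ℝ => r ^ (3 - 1) • (Ici d).indicator (fun r => r ^ (-(4 : ℝ))) r) =
      (Ici d).indicator (fun r => r ^ 2 * r ^ (-(4 : ℝ))) := by
    funext r
    by_cases hr : r ∈ Ici d
    · simp [indicator_of_mem hr]
    · simp [indicator_of_notMem hr]
  rw [hfun, integral_indicator measurableSet_Ici, Measure.restrict_restrict measurableSet_Ici]
  have hset : Ici d ∩ Ioi (0 : ℝ) = Ici d := inter_eq_left.2 fun r hr => lt_of_lt_of_le hd hr
  rw [hset, integral_Ici_eq_integral_Ioi]
  have hcongr : ∀ r ∈ Ioi d, r ^ 2 * r ^ (-(4 : ℝ)) = r ^ (-(2 : ℝ)) := by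
    intro r hr
    have hr0 : 0 < r := hd.trans hr
    rw [show r ^ 2 = r ^ ((2 : ℕ) : ℝ) from (Real.rpow_natCast r 2).symm, ← Real.rpow_add hr0]
    norm_num
  rw [setIntegral_congr_fun measurableSet_Ioi hcongr,
    integral_Ioi_rpow_of_lt (by norm_num : (-(2 : ℝ)) < -1) hd]
  have h1 : (-(2 : ℝ)) + 1 = -1 := by norm_num
  rw [h1, Real.rpow_neg_one]
  field_simp

/-- **Exterior mass of `‖z‖^{−4}` in `ℝ³`** (polar coordinates, `|B₁| = 4π/3`):
`∫_{‖z‖ ≥ d} ‖z‖^{−4} dz = 4π/d` for `d > 0`. -/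
theorem integral_indicator_compl_ball_norm_rpow_neg_four {d : ℝ} (hd : 0 < d) :
    ∫ z : EuclideanSpace ℝ (Fin 3),
        (Metric.ball (0 : EuclideanSpace ℝ (Fin 3)) d)ᶜ.indicator (fun z => ‖z‖ ^ (-(4 : ℝ))) z =
      4 * Real.pi / d := by
  have hfun : (Metric.ball (0 : EuclideanSpace ℝ (Fin 3)) d)ᶜ.indicator
        (fun z : EuclideanSpace ℝ (Fin 3) => ‖z‖ ^ (-(4 : ℝ))) =
      fun z : EuclideanSpace ℝ (Fin 3) => (Ici d).indicator (fun r => r ^ (-(4 : ℝ))) ‖z‖ := by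
    funext z
    by_cases hz : z ∈ (Metric.ball (0 : EuclideanSpace ℝ (Fin 3)) d)ᶜ
    · have hz' : ‖z‖ ∈ Ici d := by
        simpa [mem_compl_iff, mem_ball_zero_iff, not_lt] using hz
      rw [indicator_of_mem hz, indicator_of_mem hz']
    · have hz' : ‖z‖ ∉ Ici d := by
        have : ‖z‖ < d := by simpa [mem_compl_iff, mem_ball_zero_iff] using hz
        simpa [mem_Ici, not_le] using this
      rw [indicator_of_notMem hz, indicator_of_notMem hz']
  rw [hfun, integral_fun_norm_addHaar (volume : Measure (EuclideanSpace ℝ (Fin 3)))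
      ((Ici d).indicator fun r => r ^ (-(4 : ℝ))),
    finrank_euclideanSpace_fin, measureReal_def, EuclideanSpace.volume_ball_fin_three, nsmul_eq_mul,
    smul_eq_mul]
  have hvol : (ENNReal.ofReal (1 : ℝ) ^ 3 * ENNReal.ofReal (Real.pi * 4 / 3)).toReal = Real.pi * 4 / 3 := by
    rw [ENNReal.ofReal_one, one_pow, one_mul, ENNReal.toReal_ofReal (by positivity)]
  rw [hvol, setIntegral_Ioi_sq_indicator_rpow_neg_four hd]
  push_cast
  field_simp

/-- The exterior majorant is integrable. -/
theorem integrable_indicator_compl_ball_norm_rpow_neg_four {d : ℝ} (hd : 0 < d) :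
    Integrable fun z : EuclideanSpace ℝ (Fin 3) =>
      (Metric.ball (0 : EuclideanSpace ℝ (Fin 3)) d)ᶜ.indicator (fun z => ‖z‖ ^ (-(4 : ℝ))) z := by
  by_contra h
  have h0 := integral_undef h
  have h1 := integral_indicator_compl_ball_norm_rpow_neg_four hd
  rw [h0] at h1
  have : (0 : ℝ) < 4 * Real.pi / d := by positivity
  linarith

/-- **Exterior Oseen weight mass, polar bound**: `∫_{‖z‖ ≥ d} (σ + ‖z‖²)^{−2} dz ≤ 4π/d` (`σ > 0`, `d > 0`). -/
theorem integral_indicator_compl_ball_weight_le {σ d : ℝ} (hσ : 0 < σ) (hd : 0 < d) :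
    ∫ z : EuclideanSpace ℝ (Fin 3),
        (Metric.ball (0 : EuclideanSpace ℝ (Fin 3)) d)ᶜ.indicator (fun z => (σ + ‖z‖ ^ 2) ^ (-(2 : ℝ))) z ≤
      4 * Real.pi / d := by
  rw [← integral_indicator_compl_ball_norm_rpow_neg_four hd]
  refine integral_mono_of_nonneg (Eventually.of_forall fun z => ?_)
    (integrable_indicator_compl_ball_norm_rpow_neg_four hd) (Eventually.of_forall fun z => ?_)
  · exact Set.indicator_nonneg (fun w _ => Real.rpow_nonneg (by positivity) _) z
  · by_cases hz : z ∈ (Metric.ball (0 : EuclideanSpace ℝ (Fin 3)) d)ᶜ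
    · simp only [indicator_of_mem hz]
      have hz0 : d ≤ ‖z‖ := by simpa [mem_compl_iff, mem_ball_zero_iff, not_lt] using hz
      have hzpos : 0 < ‖z‖ := hd.trans_le hz0
      calc (σ + ‖z‖ ^ 2) ^ (-(2 : ℝ)) ≤ (‖z‖ ^ 2) ^ (-(2 : ℝ)) :=
            Real.rpow_le_rpow_of_nonpos (by positivity) (by linarith) (by norm_num)
        _ = ‖z‖ ^ (-(4 : ℝ)) := by
            rw [show ‖z‖ ^ 2 = ‖z‖ ^ ((2 : ℕ) : ℝ) from (Real.rpow_natCast ‖z‖ 2).symm,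
              ← Real.rpow_mul hzpos.le]
            norm_num
    · simp only [indicator_of_notMem hz, le_refl]


/-! ### §1c (continued): the two-region slice bound for a RECEDING ball (inside sup, outside Type-I field) -/

/-- **Receding-ball slice bound.**  Let `σ > 0`, `d > 0`, `‖x‖ ≤ ρ − d`.  If `‖a(y)‖² ≤ P` for `‖y‖ < ρ` and
`‖a(y)‖ ≤ M_f` for `‖y‖ ≥ ρ`, then
`‖N_σ[a,a](x)‖ ≤ C P I σ^{−1/2} + C M_f² · min(I σ^{−1/2}, 4π/d)`:
inside sources by the `L¹` size `I σ^{−1/2}` of the kernel, outside sources (at distance `≥ d` from `x`) by the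
same `L¹` size OR by the polar exterior mass `∫_{‖z‖≥d}‖z‖^{−4} = 4π/d`.  This is the slice estimate of the S3♭
receding-ball bootstrap (card §Addendum, T2). -/
theorem norm_oseenSlice_receding {C : ℝ} (hC : 0 < C)
    (hK : ∀ {τ : ℝ}, 0 < τ → ∀ z a b : EuclideanSpace ℝ (Fin 3),
      ‖oseenKernel τ z a b‖ ≤ C * (τ + ‖z‖ ^ 2) ^
        (-(((Module.finrank ℝ (EuclideanSpace ℝ (Fin 3)) : ℝ) + 1) / 2)) * ‖a‖ * ‖b‖)
    {σ P Mf ρ d : ℝ} (hσ : 0 < σ) (hP : 0 ≤ P) (hd : 0 < d)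
    {a : EuclideanSpace ℝ (Fin 3) → EuclideanSpace ℝ (Fin 3)}
    (hin : ∀ y, ‖y‖ < ρ → ‖a y‖ ^ 2 ≤ P)
    (hout : ∀ y, ρ ≤ ‖y‖ → ‖a y‖ ≤ Mf)
    {x : EuclideanSpace ℝ (Fin 3)} (hx : ‖x‖ ≤ ρ - d) :
    ‖oseenSlice σ a a x‖ ≤
      C * P * (∫ w : EuclideanSpace ℝ (Fin 3), (1 + ‖w‖ ^ 2) ^
          (-(((Module.finrank ℝ (EuclideanSpace ℝ (Fin 3)) : ℝ) + 1) / 2))) * σ ^ (-(1 / 2 : ℝ)) +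
      C * Mf ^ 2 * min ((∫ w : EuclideanSpace ℝ (Fin 3), (1 + ‖w‖ ^ 2) ^
          (-(((Module.finrank ℝ (EuclideanSpace ℝ (Fin 3)) : ℝ) + 1) / 2))) * σ ^ (-(1 / 2 : ℝ)))
        (4 * Real.pi / d) := by
  set e : ℝ := ((Module.finrank ℝ (EuclideanSpace ℝ (Fin 3)) : ℝ) + 1) / 2 with he_def
  have he : e = 2 := oseen_exponent_eq_two
  set I : ℝ := ∫ w : EuclideanSpace ℝ (Fin 3), (1 + ‖w‖ ^ 2) ^ (-e) with hI_def
  -- common pieces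
  set h₁ : EuclideanSpace ℝ (Fin 3) → ℝ := fun y => C * P * (σ + ‖x - y‖ ^ 2) ^ (-e) with hh₁
  have hi₁ : Integrable h₁ :=
    ((integrable_add_norm_sq_rpow_neg_half_succ (E := EuclideanSpace ℝ (Fin 3)) hσ).comp_sub_left x).const_mul
      (C * P)
  have hnn₁ : ∀ y, 0 ≤ h₁ y := fun y => by
    rw [hh₁]; exact mul_nonneg (by positivity) (Real.rpow_nonneg (by positivity) _)
  have hI₁ : ∫ y, h₁ y = C * P * I * σ ^ (-(1 / 2 : ℝ)) := by
    rw [hh₁, integral_const_mul]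
    have hW := integral_sub_left_eq_self (fun z : EuclideanSpace ℝ (Fin 3) => (σ + ‖z‖ ^ 2) ^ (-e)) volume x
    rw [hW, integral_add_norm_sq_rpow_neg_half_succ hσ, hI_def]
    ring
  have hkb : ∀ y, ‖oseenKernel σ (x - y) (a y) (a y)‖ ≤ C * (σ + ‖x - y‖ ^ 2) ^ (-e) * ‖a y‖ ^ 2 := by
    intro y
    calc ‖oseenKernel σ (x - y) (a y) (a y)‖ ≤ C * (σ + ‖x - y‖ ^ 2) ^ (-e) * ‖a y‖ * ‖a y‖ :=
          hK hσ (x - y) (a y) (a y)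
      _ = C * (σ + ‖x - y‖ ^ 2) ^ (-e) * ‖a y‖ ^ 2 := by ring
  have hdist : ∀ y, ρ ≤ ‖y‖ → d ≤ ‖x - y‖ := fun y hy => by
    linarith [norm_sub_norm_le y x, norm_sub_rev x y]
  -- generic two-region step: any outside majorant `g` with `C Mf² (σ+‖x−y‖²)^{-e} ≤ g y` off the ball
  have hstep : ∀ g : EuclideanSpace ℝ (Fin 3) → ℝ, Integrable g → (∀ y, 0 ≤ g y) →
      (∀ y, ρ ≤ ‖y‖ → C * Mf ^ 2 * (σ + ‖x - y‖ ^ 2) ^ (-e) ≤ g y) →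
      ‖oseenSlice σ a a x‖ ≤ C * P * I * σ ^ (-(1 / 2 : ℝ)) + ∫ y, g y := by
    intro g hgi hgnn hgout
    have hptw : ∀ y, ‖oseenKernel σ (x - y) (a y) (a y)‖ ≤ h₁ y + g y := by
      intro y
      have hw0 : 0 ≤ (σ + ‖x - y‖ ^ 2) ^ (-e) := Real.rpow_nonneg (by positivity) _
      by_cases hy : ‖y‖ < ρ
      · have h1 : C * (σ + ‖x - y‖ ^ 2) ^ (-e) * ‖a y‖ ^ 2 ≤ h₁ y := by
          rw [hh₁]
          calc C * (σ + ‖x - y‖ ^ 2) ^ (-e) * ‖a y‖ ^ 2 ≤ C * (σ + ‖x - y‖ ^ 2) ^ (-e) * P :=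
                mul_le_mul_of_nonneg_left (hin y hy) (by positivity)
            _ = C * P * (σ + ‖x - y‖ ^ 2) ^ (-e) := by ring
        linarith [hkb y, h1, hgnn y]
      · have hy' : ρ ≤ ‖y‖ := not_lt.1 hy
        have ha2 : ‖a y‖ ^ 2 ≤ Mf ^ 2 := pow_le_pow_left₀ (norm_nonneg _) (hout y hy') 2
        have h2 : C * (σ + ‖x - y‖ ^ 2) ^ (-e) * ‖a y‖ ^ 2 ≤ g y := by
          calc C * (σ + ‖x - y‖ ^ 2) ^ (-e) * ‖a y‖ ^ 2 ≤ C * (σ + ‖x - y‖ ^ 2) ^ (-e) * Mf ^ 2 :=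
                mul_le_mul_of_nonneg_left ha2 (by positivity)
            _ = C * Mf ^ 2 * (σ + ‖x - y‖ ^ 2) ^ (-e) := by ring
            _ ≤ g y := hgout y hy'
        linarith [hkb y, h2, hnn₁ y]
    rw [oseenSlice_apply]
    have hsum : Integrable (fun y => h₁ y + g y) := hi₁.add hgi
    refine (norm_integral_le_of_norm_le hsum (Eventually.of_forall hptw)).trans ?_
    rw [integral_add hi₁ hgi, hI₁]
  -- version 1: outside by the same `L¹` size
  have hv1 : ‖oseenSlice σ a a x‖ ≤ C * P * I * σ ^ (-(1 / 2 : ℝ)) + C * Mf ^ 2 * (I * σ ^ (-(1 / 2 : ℝ))) := by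
    set g : EuclideanSpace ℝ (Fin 3) → ℝ := fun y => C * Mf ^ 2 * (σ + ‖x - y‖ ^ 2) ^ (-e) with hg
    have hgi : Integrable g :=
      ((integrable_add_norm_sq_rpow_neg_half_succ (E := EuclideanSpace ℝ (Fin 3)) hσ).comp_sub_left x).const_mul
        (C * Mf ^ 2)
    have hgI : ∫ y, g y = C * Mf ^ 2 * (I * σ ^ (-(1 / 2 : ℝ))) := by
      rw [hg, integral_const_mul]
      have hW := integral_sub_left_eq_self (fun z : EuclideanSpace ℝ (Fin 3) => (σ + ‖z‖ ^ 2) ^ (-e)) volume x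
      rw [hW, integral_add_norm_sq_rpow_neg_half_succ hσ, hI_def]
      ring
    have := hstep g hgi (fun y => by rw [hg]; exact mul_nonneg (by positivity) (Real.rpow_nonneg (by positivity) _))
      (fun y _ => by rw [hg])
    rwa [hgI] at this
  -- version 2: outside by the polar exterior mass
  have hv2 : ‖oseenSlice σ a a x‖ ≤ C * P * I * σ ^ (-(1 / 2 : ℝ)) + C * Mf ^ 2 * (4 * Real.pi / d) := by
    set g : EuclideanSpace ℝ (Fin 3) → ℝ := fun y => C * Mf ^ 2 *
      (Metric.ball (0 : EuclideanSpace ℝ (Fin 3)) d)ᶜ.indicator (fun z => ‖z‖ ^ (-(4 : ℝ))) (x - y) with hg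
    have hgi : Integrable g :=
      ((integrable_indicator_compl_ball_norm_rpow_neg_four hd).comp_sub_left x).const_mul (C * Mf ^ 2)
    have hgI : ∫ y, g y = C * Mf ^ 2 * (4 * Real.pi / d) := by
      rw [hg, integral_const_mul]
      have hW := integral_sub_left_eq_self
        (fun z : EuclideanSpace ℝ (Fin 3) =>
          (Metric.ball (0 : EuclideanSpace ℝ (Fin 3)) d)ᶜ.indicator (fun z => ‖z‖ ^ (-(4 : ℝ))) z) volume x
      rw [hW, integral_indicator_compl_ball_norm_rpow_neg_four hd]
    have hgnn : ∀ y, 0 ≤ g y := fun y => by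
      rw [hg]
      exact mul_nonneg (by positivity) (Set.indicator_nonneg (fun w _ => Real.rpow_nonneg (norm_nonneg _) _) _)
    have hgout : ∀ y, ρ ≤ ‖y‖ → C * Mf ^ 2 * (σ + ‖x - y‖ ^ 2) ^ (-e) ≤ g y := by
      intro y hy
      have hdy := hdist y hy
      have hmem : x - y ∈ (Metric.ball (0 : EuclideanSpace ℝ (Fin 3)) d)ᶜ := by
        rw [mem_compl_iff, mem_ball_zero_iff, not_lt]; exact hdy
      rw [hg]
      simp only [indicator_of_mem hmem]
      have hzpos : 0 < ‖x - y‖ := hd.trans_le hdy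
      have hwe : (σ + ‖x - y‖ ^ 2) ^ (-e) ≤ ‖x - y‖ ^ (-(4 : ℝ)) := by
        rw [he]
        calc (σ + ‖x - y‖ ^ 2) ^ (-(2 : ℝ)) ≤ (‖x - y‖ ^ 2) ^ (-(2 : ℝ)) :=
              Real.rpow_le_rpow_of_nonpos (by positivity) (by linarith) (by norm_num)
          _ = ‖x - y‖ ^ (-(4 : ℝ)) := by
              rw [show ‖x - y‖ ^ 2 = ‖x - y‖ ^ ((2 : ℕ) : ℝ) from (Real.rpow_natCast ‖x - y‖ 2).symm,
                ← Real.rpow_mul hzpos.le]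
              norm_num
      exact mul_le_mul_of_nonneg_left hwe (by positivity)
    have := hstep g hgi hgnn hgout
    rwa [hgI] at this
  -- combine
  rcases min_cases (I * σ ^ (-(1 / 2 : ℝ))) (4 * Real.pi / d) with ⟨hmin, _⟩ | ⟨hmin, _⟩
  · rw [hmin]; exact hv1
  · rw [hmin]; exact hv2


/-! ### §1c (continued): two-region maximum principle for the caloric extension (Gaussian tail) -/

/-- Heat-kernel comparison off a ball in `ℝ³`: for `‖y‖ ≥ δ`,
`G_σ(y) ≤ 2^{3/2} e^{−δ²/(8σ)} · G_{2σ}(y)`. -/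
theorem heatKernel_le_tail_mul_heatKernel_two_mul {σ δ : ℝ} (hσ : 0 < σ) (hδ : 0 ≤ δ)
    {y : EuclideanSpace ℝ (Fin 3)} (hy : δ ≤ ‖y‖) :
    UnboundedOperators.heatKernel σ y ≤
      (2 : ℝ) ^ (3 / 2 : ℝ) * Real.exp (-(δ ^ 2 / (8 * σ))) * UnboundedOperators.heatKernel (2 * σ) y := by
  rw [UnboundedOperators.heatKernel_eq, UnboundedOperators.heatKernel_eq, finrank_euclideanSpace_fin]
  simp only [Nat.cast_ofNat]
  have h2pos : (0 : ℝ) < (2 : ℝ) ^ (3 / 2 : ℝ) := by positivity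
  have h4 : (0 : ℝ) ≤ 4 * Real.pi * σ := by positivity
  -- normalisations: `(4πσ)^{-3/2} = 2^{3/2} (8πσ)^{-3/2}`
  have hnorm : (4 * Real.pi * σ) ^ (-(3 : ℝ) / 2) =
      (2 : ℝ) ^ (3 / 2 : ℝ) * (4 * Real.pi * (2 * σ)) ^ (-(3 : ℝ) / 2) := by
    have h8 : 4 * Real.pi * (2 * σ) = 2 * (4 * Real.pi * σ) := by ring
    rw [h8, Real.mul_rpow zero_le_two h4, ← mul_assoc, show (-(3 : ℝ) / 2) = -(3 / 2 : ℝ) by ring,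
      Real.rpow_neg zero_le_two, mul_inv_cancel₀ h2pos.ne', one_mul]
  -- exponentials: `e^{-‖y‖²/(4σ)} ≤ e^{-δ²/(8σ)} e^{-‖y‖²/(8σ)}`
  have hexp : Real.exp (-(1 / (4 * σ)) * ‖y‖ ^ 2) ≤
      Real.exp (-(δ ^ 2 / (8 * σ))) * Real.exp (-(1 / (4 * (2 * σ))) * ‖y‖ ^ 2) := by
    rw [← Real.exp_add]
    refine Real.exp_le_exp.2 ?_
    have hy2 : δ ^ 2 ≤ ‖y‖ ^ 2 := pow_le_pow_left₀ hδ hy 2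
    rw [show -(1 / (4 * σ)) * ‖y‖ ^ 2 = -(‖y‖ ^ 2 / (8 * σ)) + -(‖y‖ ^ 2 / (8 * σ)) by field_simp; ring,
      show -(1 / (4 * (2 * σ))) * ‖y‖ ^ 2 = -(‖y‖ ^ 2 / (8 * σ)) by field_simp; ring]
    have : δ ^ 2 / (8 * σ) ≤ ‖y‖ ^ 2 / (8 * σ) := div_le_div_of_nonneg_right hy2 (by positivity)
    linarith
  have hA : 0 ≤ (4 * Real.pi * (2 * σ)) ^ (-(3 : ℝ) / 2) := Real.rpow_nonneg (by positivity) _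
  rw [hnorm]
  calc (2 : ℝ) ^ (3 / 2 : ℝ) * (4 * Real.pi * (2 * σ)) ^ (-(3 : ℝ) / 2) * Real.exp (-(1 / (4 * σ)) * ‖y‖ ^ 2)
      ≤ (2 : ℝ) ^ (3 / 2 : ℝ) * (4 * Real.pi * (2 * σ)) ^ (-(3 : ℝ) / 2) *
          (Real.exp (-(δ ^ 2 / (8 * σ))) * Real.exp (-(1 / (4 * (2 * σ))) * ‖y‖ ^ 2)) :=
        mul_le_mul_of_nonneg_left hexp (by positivity)
    _ = _ := by ring

/-- **Two-region maximum principle.**  If `‖f‖ ≤ a` on the ball `B(x,δ)` and `‖f‖ ≤ A` everywhere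
(`a, A ≥ 0`, `δ, σ > 0`), then `‖e^{σΔ}f(x)‖ ≤ a + 2^{3/2} A e^{−δ²/(8σ)}`:
the data near `x` enter with the unit mass of `G_σ`, the data off `B(x,δ)` with its Gaussian tail.
This is the heat part of the S3♭ receding-ball bootstrap (card §Addendum, T3). -/
theorem norm_heatExtension_two_region {f : EuclideanSpace ℝ (Fin 3) → EuclideanSpace ℝ (Fin 3)}
    {a A δ σ : ℝ} (ha : 0 ≤ a) (hA : 0 ≤ A) (hδ : 0 ≤ δ) (hσ : 0 < σ)
    {x : EuclideanSpace ℝ (Fin 3)}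
    (hin : ∀ z, ‖z - x‖ < δ → ‖f z‖ ≤ a) (hout : ∀ z, ‖f z‖ ≤ A) :
    ‖UnboundedOperators.heatExtension f σ x‖ ≤
      a + (2 : ℝ) ^ (3 / 2 : ℝ) * A * Real.exp (-(δ ^ 2 / (8 * σ))) := by
  rw [UnboundedOperators.heatExtension_apply]
  set T : ℝ := (2 : ℝ) ^ (3 / 2 : ℝ) * Real.exp (-(δ ^ 2 / (8 * σ))) with hT
  have hT0 : 0 ≤ T := by rw [hT]; positivity
  set g : EuclideanSpace ℝ (Fin 3) → ℝ := fun y =>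
    a * UnboundedOperators.heatKernel σ y + A * T * UnboundedOperators.heatKernel (2 * σ) y with hg
  have hG1 := UnboundedOperators.integrable_heatKernel_holds (E := EuclideanSpace ℝ (Fin 3)) hσ
  have hG2 := UnboundedOperators.integrable_heatKernel_holds (E := EuclideanSpace ℝ (Fin 3))
    (by positivity : (0 : ℝ) < 2 * σ)
  have hgi : Integrable g := (hG1.const_mul a).add (hG2.const_mul (A * T))
  have hptw : ∀ y, ‖UnboundedOperators.heatKernel σ y • f (x - y)‖ ≤ g y := by
    intro y
    have hk0 : 0 ≤ UnboundedOperators.heatKernel σ y := (UnboundedOperators.heatKernel_pos hσ y).le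
    have hk2 : 0 ≤ UnboundedOperators.heatKernel (2 * σ) y :=
      (UnboundedOperators.heatKernel_pos (by positivity) y).le
    rw [norm_smul, Real.norm_of_nonneg hk0, hg]
    by_cases hy : ‖y‖ < δ
    · have h1 : ‖f (x - y)‖ ≤ a := hin (x - y) (by rw [sub_sub_cancel_left, norm_neg]; exact hy)
      have : UnboundedOperators.heatKernel σ y * ‖f (x - y)‖ ≤ a * UnboundedOperators.heatKernel σ y := by
        rw [mul_comm]; exact mul_le_mul_of_nonneg_right h1 hk0
      have h2 : 0 ≤ A * T * UnboundedOperators.heatKernel (2 * σ) y := by positivity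
      linarith
    · have hy' : δ ≤ ‖y‖ := not_lt.1 hy
      have htail := heatKernel_le_tail_mul_heatKernel_two_mul hσ hδ hy'
      have h1 : UnboundedOperators.heatKernel σ y * ‖f (x - y)‖ ≤
          T * UnboundedOperators.heatKernel (2 * σ) y * A := by
        rw [hT]
        exact mul_le_mul htail (hout _) (norm_nonneg _) (by positivity)
      have h2 : 0 ≤ a * UnboundedOperators.heatKernel σ y := by positivity
      linarith
  refine (norm_integral_le_of_norm_le hgi (Eventually.of_forall hptw)).trans (le_of_eq ?_)
  rw [hg, integral_add (hG1.const_mul a) (hG2.const_mul (A * T)), integral_const_mul, integral_const_mul,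
    UnboundedOperators.integral_heatKernel_eq_one_holds hσ,
    UnboundedOperators.integral_heatKernel_eq_one_holds (by positivity : (0 : ℝ) < 2 * σ), hT]
  ring


/-- **QC from S3♭ and S4♭** (kernel-checked composition). -/
theorem quietCore_of_upgrade_of_pass {M B : ℝ} (h3 : SubcriticalUpgrade M) (h4 : BudgetPass M B) :
    QuietCore M B := by
  obtain ⟨c₀, s₁, hc₀, hs₁, hup⟩ := h3
  obtain ⟨s₂, K, hs₂, hK, hpass⟩ := h4 c₀ hc₀
  refine ⟨c₀, max s₁ s₂, K, hc₀, max_lt hs₁ hs₂, hK, fun v hv hBv s hs hq t ht x hx => ?_⟩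
  have hs1 : s ∈ Set.Ico s₁ 0 := ⟨(le_max_left _ _).trans hs.1, hs.2⟩
  have hs2 : s ∈ Set.Ico s₂ 0 := ⟨(le_max_right _ _).trans hs.1, hs.2⟩
  exact hpass v hv hBv s hs2 (hup v hv s hs1 hq) t ht x hx

/-- `stubQuietCore_of` (line `quiet_core` §1c, ns-idea-7 g10; ported verbatim). [this file] -/
theorem stubQuietCore_of (h3 : StubSubcriticalUpgrade) (h4 : StubBudgetPass) : StubQuietCore :=
  fun M B => quietCore_of_upgrade_of_pass (h3 M) (h4 M B)


end Summit.NavierStokesRegularity.NavierStokesRegularity.Cruxes.TypeIQuantSubcubicExp.QuietCore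

end
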